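import Summits.AtomisticToContinuum.BoseEinsteinCondensation.Theses.BECCutLineWeakDisorder
import HarnessLib

/-!
# Route `BECCutLineWeakDisorder`, crux `TwoReplicaTransienceBound` (stmt-AtomisticToContinuum-9687):
# vocabulary, stub statements and sorry-free compositions of the line `late-core-split`

Route-posited statements (D-0016 `<Route>Defs`-style file; precedents `…AcrossCutDefs.lean`,
`…TaggedShiftDefs.lean`, `BECCutLineWeakDisorderDefs.lean` of this crux). Authored by the crux
strategist (unit cstrat-stmt-AtomisticToContinuum-9687-s1, `Cruxes/TwoReplicaTransienceBound/
Lines/late_core_split.lean`, census `…/STRATEGY-CENSUS.md`), landed VERBATIM by the adopting lead c7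
(planner seats cannot write under `Theorems/`). NOTHING IS ASSERTED: `overlap`, `sliceMassSq` are
honest definitions over `fkWitness`; every `def … : Prop` is a *statement* (a registered stub
signature or a named intermediate), consumed only as the type of a stub theorem or as a hypothesis
of the sorry-free compositions proved below.

**The crux** (`Theses/BECCutLineWeakDisorder.lean`, `def TwoReplicaTransienceBound`): for admissible
`v`, `0 < ρ < ρ₀(v)`, some `C`, all large `n` and EVERY half-length `T ≥ 1`,
`I(T) := ∫ L³ m_T(Y)²/s_T(Y)² dY ≤ C` for `Ψ_T = fkWitness v L T 1`, `L = sideLength ρ (n+1)`.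

**The line (decomposition along the two uniformities).** `crux ⟺ Z ∧ A ∧ O` with
Z = `WitnessZeroMode` (late-`T` zero-mode ODLRO of the heat-flow witness: `S(T) = ∫ s_T² ≥ cL³`,
i.e. flat-mode occupation `≥ c(n+1)` — the summit-strength core), A = `OverlapNoIntermittency`
(late-`T` reverse-Jensen / `A₂` condition `I(T)·S(T) ≤ C₂L³`, i.e. `E_Q[PR]·E_Q[1/PR] ≤ C₂`),
O = `NoTransientOvershoot` (`I(T) ≤ C₀(1 + I(T'))` for `1 ≤ T ≤ T'`, crux-implied). The point for the
ROUTE: `closes` consumes the crux through `WitnessTransfer`, whose glue uses the bound at ONE late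
`T`; so `LateTwoReplicaBound` (`⟸ Z ∧ A`, `late_of_zeroMode_noIntermittency`) plus the PROVABLE stub
`stub_lateWitnessTransfer : LateTwoReplicaBound → LandscapeBound` (landed in
`…LateCoreSplitLateWitnessTransfer.lean` via `glue_landscape_at_late`) gives the hinge without O
(`landscapeBound_of_late`).

**Registered stubs** (skeleton `Lines/late_core_split.lean`): `stub_witnessZeroMode` (OPEN, core),
`stub_overlapNoIntermittency` (OPEN, conjecture input), `stub_noTransientOvershoot` (OPEN, only for
the `∀T` parent), `stub_lateWitnessTransfer` (provable; landed separately), and the bookkeeping stub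
`stub_lateCoreCompose` (PROVED here). Also proved HERE (sorry-free):
`late_of_zeroMode_noIntermittency` (Z → A → Late), `twoReplicaTransienceBound_of_late` (Late → O →
crux), `TwoReplicaTransienceBound_of` (Z → A → O → crux BY NAME), `landscapeBound_of_late`
(Z → A → lateWitnessTransfer → LandscapeBound), `noTransientOvershoot_of_crux`, `late_of_crux`.

References (for the objects and the DPRE analogy only): E. Bolthausen, CMP 123 (1989); M. Birkner,
ECP 9 (2004) (weak disorder with `E[W²] = ∞`); S. Junk, Ann. Probab. (2025), S. Junk, H. Lacoin,
CMP (2025) (intermittency of the partition function near `β_c`).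
-/

noncomputable section

open MeasureTheory Filter Set
open scoped ENNReal NNReal Topology

namespace Summit.AtomisticToContinuum.BoseEinsteinCondensation.Cruxes.TwoReplicaTransienceBound.LateCoreSplit

open Literature.MathematicalPhysics.QuantumManyBody.BoseGas
open Summit.AtomisticToContinuum.BoseEinsteinCondensation.Theses.BECCutLineWeakDisorder

/-! ### Objects and statements -/

/-- The crux functional `I(v, ρ, n, T) = ∫ L³ m_T(Y)²/s_T(Y)² dY` (`E_Q[PR]`). -/
def overlap (v : ℝ → ℝ≥0∞) (ρ : ℝ) (n : ℕ) (T : ℝ) : ℝ≥0∞ :=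
  ∫⁻ Y : Config n, ENNReal.ofReal (sideLength ρ (n + 1) ^ 3) *
    (∫⁻ x, (‖@fkWitness (n + 1) v (sideLength ρ (n + 1)) T (fun _ => (1 : ENNReal))
      (Matrix.vecCons x Y)‖₊ : ENNReal) ^ 2) ^ 2 /
    (∫⁻ x, (‖@fkWitness (n + 1) v (sideLength ρ (n + 1)) T (fun _ => (1 : ENNReal))
      (Matrix.vecCons x Y)‖₊ : ENNReal)) ^ 2

/-- The slice-mass square `S(v, ρ, n, T) = ∫ s_T(Y)² dY` (`= L³ · occ(φ₀, Ψ_T)/(n+1) = L³ E_Q[1/PR]`). -/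
def sliceMassSq (v : ℝ → ℝ≥0∞) (ρ : ℝ) (n : ℕ) (T : ℝ) : ℝ≥0∞ :=
  ∫⁻ Y : Config n, (∫⁻ x, (‖@fkWitness (n + 1) v (sideLength ρ (n + 1)) T (fun _ => (1 : ENNReal))
      (Matrix.vecCons x Y)‖₊ : ENNReal)) ^ 2

/-- Z — zero-mode ODLRO of the heat-flow witness at late polymer length (the core). -/
def WitnessZeroMode : Prop :=
  ∀ v : ℝ → ℝ≥0∞, IsRepulsiveFiniteRange v → ∃ ρ₀ : ℝ, 0 < ρ₀ ∧ ∀ ρ : ℝ, 0 < ρ → ρ < ρ₀ →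
    ∃ c : ℝ, 0 < c ∧ ∀ᶠ n : ℕ in atTop, ∀ᶠ T : ℝ in atTop,
      ENNReal.ofReal (c * sideLength ρ (n + 1) ^ 3) ≤ sliceMassSq v ρ n T

/-- A — the `A₂` / no-intermittency condition of the overlap at late polymer length. -/
def OverlapNoIntermittency : Prop :=
  ∀ v : ℝ → ℝ≥0∞, IsRepulsiveFiniteRange v → ∃ ρ₀ : ℝ, 0 < ρ₀ ∧ ∀ ρ : ℝ, 0 < ρ → ρ < ρ₀ →
    ∃ C₂ : ℝ, 0 < C₂ ∧ ∀ᶠ n : ℕ in atTop, ∀ᶠ T : ℝ in atTop,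
      overlap v ρ n T * sliceMassSq v ρ n T ≤ ENNReal.ofReal C₂ * ENNReal.ofReal (sideLength ρ (n + 1) ^ 3)

/-- O — no transient overshoot of the overlap in the polymer length. -/
def NoTransientOvershoot : Prop :=
  ∀ v : ℝ → ℝ≥0∞, IsRepulsiveFiniteRange v → ∃ ρ₀ : ℝ, 0 < ρ₀ ∧ ∀ ρ : ℝ, 0 < ρ → ρ < ρ₀ →
    ∃ C₀ : ℝ, 0 < C₀ ∧ ∀ᶠ n : ℕ in atTop, ∀ T T' : ℝ, 1 ≤ T → T ≤ T' →
      overlap v ρ n T ≤ ENNReal.ofReal C₀ * (1 + overlap v ρ n T')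

/-- Late — the late-time two-replica bound (the crux with `∀ T ≥ 1` replaced by `∀ᶠ T`): exactly
what `glue_landscape_at` consumes. -/
def LateTwoReplicaBound : Prop :=
  ∀ v : ℝ → ℝ≥0∞, IsRepulsiveFiniteRange v → ∃ ρ₀ : ℝ, 0 < ρ₀ ∧ ∀ ρ : ℝ, 0 < ρ → ρ < ρ₀ →
    ∃ C : ℝ, 0 < C ∧ ∀ᶠ n : ℕ in atTop, ∀ᶠ T : ℝ in atTop, overlap v ρ n T ≤ ENNReal.ofReal C

namespace Goal
/-- Registered stub signature (core, OPEN). -/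
abbrev stub_witnessZeroMode : Prop := WitnessZeroMode
/-- Registered stub signature (conjecture input, OPEN). -/
abbrev stub_overlapNoIntermittency : Prop := OverlapNoIntermittency
/-- Registered stub signature (OPEN; only for the `∀T` parent). -/
abbrev stub_noTransientOvershoot : Prop := NoTransientOvershoot
/-- Registered stub signature (PROVABLE NOW, M): the late bound already gives the hinge. -/
abbrev stub_lateWitnessTransfer : Prop := LateTwoReplicaBound → LandscapeBound
/-- Registered bookkeeping stub `stub_lateCoreCompose`: the three stub statements Z, A, O imply the
crux `TwoReplicaTransienceBound` BY NAME (proved below as `stub_lateCoreCompose`; registered so that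
this shared vocabulary file lands as a `--supports` file — precedents `stub_tracerCompose`,
`stub_taggedShiftCompose`, `stub_acrossCutCompose` of this crux). -/
abbrev stub_lateCoreCompose : Prop :=
  stub_witnessZeroMode → stub_overlapNoIntermittency → stub_noTransientOvershoot →
    Summit.AtomisticToContinuum.BoseEinsteinCondensation.Theses.BECCutLineWeakDisorder.TwoReplicaTransienceBound
end Goal

/-! ### Sorry-free compositions -/

/-- `[0,∞]` algebra: `c·L³ ≤ S` and `I·S ≤ C₂·L³` give `I ≤ C₂/c`. -/
theorem overlap_le_of_zeroMode_noIntermittency {I S : ℝ≥0∞} {c C₂ L3 : ℝ} (hc : 0 < c)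
    (hL3 : 0 < L3) (hC₂ : 0 ≤ C₂) (hZ : ENNReal.ofReal (c * L3) ≤ S)
    (hA : I * S ≤ ENNReal.ofReal C₂ * ENNReal.ofReal L3) : I ≤ ENNReal.ofReal (C₂ / c) := by
  have hcL : ENNReal.ofReal (c * L3) ≠ 0 := (ENNReal.ofReal_pos.2 (mul_pos hc hL3)).ne'
  have h1 : I * ENNReal.ofReal (c * L3) ≤ ENNReal.ofReal C₂ * ENNReal.ofReal L3 :=
    (mul_le_mul' le_rfl hZ).trans hA
  have h2 : I ≤ ENNReal.ofReal C₂ * ENNReal.ofReal L3 / ENNReal.ofReal (c * L3) :=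
    (ENNReal.le_div_iff_mul_le (Or.inl hcL) (Or.inl ENNReal.ofReal_ne_top)).2 h1
  refine h2.trans (le_of_eq ?_)
  rw [← ENNReal.ofReal_mul hC₂, ← ENNReal.ofReal_div_of_pos (mul_pos hc hL3)]
  congr 1
  field_simp

/-- `L³ > 0` for `L = sideLength ρ (n+1)`, `ρ > 0`. -/
theorem sideLength_cube_pos {ρ : ℝ} (hρ : 0 < ρ) (n : ℕ) : 0 < sideLength ρ (n + 1) ^ 3 :=
  pow_pos (Real.rpow_pos_of_pos (div_pos (Nat.cast_pos.mpr n.succ_pos) hρ) _) 3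

/-- **Z ∧ A ⇒ Late** (sorry-free): the late-time two-replica bound from zero-mode ODLRO and
no-intermittency, constant `C₂/c`. -/
theorem late_of_zeroMode_noIntermittency (hZ : WitnessZeroMode) (hA : OverlapNoIntermittency) :
    LateTwoReplicaBound := by
  intro v hv
  obtain ⟨ρ₁, hρ₁, H1⟩ := hZ v hv
  obtain ⟨ρ₂, hρ₂, H2⟩ := hA v hv
  refine ⟨min ρ₁ ρ₂, lt_min hρ₁ hρ₂, fun ρ hρ hρlt => ?_⟩
  obtain ⟨c, hc, evZ⟩ := H1 ρ hρ (hρlt.trans_le (min_le_left _ _))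
  obtain ⟨C₂, hC₂, evA⟩ := H2 ρ hρ (hρlt.trans_le (min_le_right _ _))
  refine ⟨C₂ / c, div_pos hC₂ hc, ?_⟩
  filter_upwards [evZ, evA] with n hnZ hnA
  filter_upwards [hnZ, hnA] with T hTZ hTA
  exact overlap_le_of_zeroMode_noIntermittency hc (sideLength_cube_pos hρ n) hC₂.le hTZ hTA

/-- **Late ∧ O ⇒ the crux BY NAME** (sorry-free). -/
theorem twoReplicaTransienceBound_of_late (hL : LateTwoReplicaBound) (hO : NoTransientOvershoot) :
    TwoReplicaTransienceBound := by
  intro v hv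
  obtain ⟨ρ₁, hρ₁, H1⟩ := hL v hv
  obtain ⟨ρ₃, hρ₃, H3⟩ := hO v hv
  refine ⟨min ρ₁ ρ₃, lt_min hρ₁ hρ₃, fun ρ hρ hρlt => ?_⟩
  obtain ⟨C, hC, evL⟩ := H1 ρ hρ (hρlt.trans_le (min_le_left _ _))
  obtain ⟨C₀, hC₀, evO⟩ := H3 ρ hρ (hρlt.trans_le (min_le_right _ _))
  refine ⟨C₀ * (1 + C), by positivity, ?_⟩
  filter_upwards [evL, evO] with n hnL hnO T hT
  obtain ⟨T', hTT', hL'⟩ := ((eventually_ge_atTop T).and hnL).exists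
  calc overlap v ρ n T ≤ ENNReal.ofReal C₀ * (1 + overlap v ρ n T') := hnO T T' hT hTT'
    _ ≤ ENNReal.ofReal C₀ * (1 + ENNReal.ofReal C) := by gcongr
    _ = ENNReal.ofReal (C₀ * (1 + C)) := by
        rw [ENNReal.ofReal_mul hC₀.le, ENNReal.ofReal_add zero_le_one hC.le, ENNReal.ofReal_one]

/-- **The composition of the line**: the registered stubs Z, A, O imply the crux BY NAME. -/
theorem TwoReplicaTransienceBound_of :
    Goal.stub_witnessZeroMode → Goal.stub_overlapNoIntermittency → Goal.stub_noTransientOvershoot →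
      Summit.AtomisticToContinuum.BoseEinsteinCondensation.Theses.BECCutLineWeakDisorder.TwoReplicaTransienceBound :=
  fun hZ hA hO => twoReplicaTransienceBound_of_late (late_of_zeroMode_noIntermittency hZ hA) hO

/-- PROVED bookkeeping stub `stub_lateCoreCompose` (= `TwoReplicaTransienceBound_of`). -/
theorem stub_lateCoreCompose : Goal.stub_lateCoreCompose := TwoReplicaTransienceBound_of

/-- **The route-level point** (sorry-free): Z, A and the PROVABLE transfer stub already give the
route's hinge `LandscapeBound` — O is not needed by `closes`. -/
theorem landscapeBound_of_late :
    Goal.stub_witnessZeroMode → Goal.stub_overlapNoIntermittency → Goal.stub_lateWitnessTransfer →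
      Summit.AtomisticToContinuum.BoseEinsteinCondensation.Theses.BECCutLineWeakDisorder.LandscapeBound :=
  fun hZ hA hW => hW (late_of_zeroMode_noIntermittency hZ hA)

/-! ### Safety and calibration (sorry-free) -/

/-- The crux implies O with the same constant: O can only fail where the crux fails. -/
theorem noTransientOvershoot_of_crux (h : TwoReplicaTransienceBound) : NoTransientOvershoot := by
  intro v hv
  obtain ⟨ρ₀, hρ₀, H⟩ := h v hv
  refine ⟨ρ₀, hρ₀, fun ρ hρ hρlt => ?_⟩
  obtain ⟨C, hC, ev⟩ := H ρ hρ hρlt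
  refine ⟨C, hC, ?_⟩
  filter_upwards [ev] with n hn T T' hT hTT'
  calc overlap v ρ n T ≤ ENNReal.ofReal C := hn T hT
    _ = ENNReal.ofReal C * 1 := (mul_one _).symm
    _ ≤ ENNReal.ofReal C * (1 + overlap v ρ n T') := by gcongr; exact le_self_add

/-- The crux implies Late trivially. -/
theorem late_of_crux (h : TwoReplicaTransienceBound) : LateTwoReplicaBound := by
  intro v hv
  obtain ⟨ρ₀, hρ₀, H⟩ := h v hv
  refine ⟨ρ₀, hρ₀, fun ρ hρ hρlt => ?_⟩
  obtain ⟨C, hC, ev⟩ := H ρ hρ hρlt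
  refine ⟨C, hC, ?_⟩
  filter_upwards [ev] with n hn
  filter_upwards [eventually_ge_atTop (1 : ℝ)] with T hT using hn T hT


end Summit.AtomisticToContinuum.BoseEinsteinCondensation.Cruxes.TwoReplicaTransienceBound.LateCoreSplit

end
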